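import Literature.MathematicalPhysics.QuantumFieldTheory.Balaban1983to89.B8Ineq192MultiLevelTorusP22L0
import Literature.MathematicalPhysics.QuantumFieldTheory.Balaban1983to89.B8Ineq198MultiLevelTorusP22L0
import Literature.MathematicalPhysics.QuantumFieldTheory.Balaban1983to89.B6Prop23MultiLevelTorusL0

/-!
# `Balaban1983to89.B8Ineq192MultiLevelTorusP23L0` — LEVEL-0 TWIN (programme G-F3′-L0's dictionary; UV3-NODE (P2-L3) ∕ P1♭ `core` junction J-N05♭, J1 of LEAD-H ★w5-19200 g4's
T2♭-PLAN v1.1, RULING L-2 (2)) of `B8Ineq192MultiLevelTorusP23`: the SAME declarations (`hPrime_single_decay_T_P23`, `hKer_decay_T_P23`, `ineq192_multiLevelTorus_P23`, `rProjMLT_sup_bound_P23`), SAME NAMES, for lit-balaban's LEVEL-0-ADMITTING torus families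
`B6MultiLevelTorusOperatorL0.TDomains` (blocks of every level `0 ≤ j ≤ k`, print p.225 (2.14) «Σ_{j=0}^k … (Q′₀λ)(x) = λ(x), x ∈ Λ₀» — the families the H-side P2 port
`FlatPort*L0∕AllL` reads), obtained by the dictionary swap `…MultiLevelTorus ↦ …MultiLevelTorusL0` of every parent (all ✓ in the tree; the L0 Prop.-2.2∕2.3 suppliers' weight
windows quantify over EVERY level `i` incl. `0`, so the level-`≥ 1` window binders of the originals lose their `1 ≤ i` guard).  Unit `ym-inputs-p09` (cell `pub/ym-inputs`,
H-side hand of cell `ym3-torus`), 2026-08-28.  No `def`, no new fact, standard axioms; every input BY NAME.  NOT summit progress; rung R3 bookkeeping, not Clay.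
THE TWIN'S DOCUMENTATION FOLLOWS VERBATIM.

# `Balaban1983to89.B8Ineq192MultiLevelTorusP23` — T. Bałaban, *Spaces of regular gauge field configurations on a lattice and
# gauge fixing conditions*, Commun. Math. Phys. **99** (1985) 75–102 [Balaban1985RegularSpaces], **(1.91)–(1.92)** p. 91, the
# p. 93 Δ-entry, «Q′H′ = I» (p. 96) and p. 92 «|Rf| ≦ B′₀|f|» **AT U₀ = 1 ON PRINT'S CARRIER — THE GENUINE `k`-LEVEL NESTED-DOMAIN
# TORUS FAMILY `T_η = Ω₁ ⊃ … ⊃ Ω_k` — HYPOTHESIS-FREE**: the argument `G` of `B8Ineq192MultiLevelTorus` /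
# `B8Ineq192MultiLevelTorusP22` instantiated with THE inverse `(Q′G′²Q′*)⁻¹ = GinvT D a` of [B6] Proposition 2.3 for this family
# (`B6Prop23MultiLevelTorus.prop23_multiLevelTorus`, seat p21 gen 16, p350221, 2026-08-23T02:58Z)

statement-level skeleton of published theorems with citation tags; proofs where landed; nothing here is a claim about the Yang–Mills mass gap

CITATION HEADER (lean-in-tree rule).  Cell `lit-balaban`, unit `lit-balaban-r05` gen 59 (B8 reader/typer and fold owner; the
announced successor step of `B8Ineq192MultiLevelTorus` p342575 / `B8Ineq192MultiLevelTorusP22` p344413, HOME/lit-balaban-r05/HANDOFF.md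
§ gen 54–58 trigger (iii-c); torus twin of `B8Ineq192MultiLevelBoxP23` p335269).  WHAT IS REPRODUCED = SKELETON rows **B8.Eq1.91**
(member (1.92) + the p. 93 Δ-entry + «Q′H′ = I») and **B8.Claim@92** («|Rf| ≦ B′₀|f|») at the flat background ON PRINT'S OWN CARRIER
`T_η`, NOW WITH NO HYPOTHESIS: `B8Ineq192MultiLevelTorus` proved the kernel decay of `H′ = G′²Q′*G`, (1.92) and «|Rf| ≦ B′₀|f|» for
EVERY operator `G` on `𝔅` carrying the printed (2.87)-bound of `(Q′G′²Q′*)⁻¹` and for the three [B6] Prop.-2.2 majorants of `G′`;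
`B8Ineq192MultiLevelTorusP22` / `B8Ineq198MultiLevelTorusP22.prop22_entries1236_multiLevelTorus` discharged the Prop.-2.2 majorants by
p21's torus Proposition 2.2 (T4–T7); p21's `B6Prop23MultiLevelTorus.prop23_multiLevelTorus` (G2 of the torus `(Q′G′²Q′*)⁻¹` programme)
now supplies, for every member of the family, THE operator `GinvT D a` WITH A BODY, with `GinvT·(Q′G′²Q′*) = 1`, `(Q′G′²Q′*)·GinvT = 1`,
uniqueness, and (2.87) in exactly the letters consumed here (`kerOp (W D.toDomains) (XkT D a)`, `(geomT D).len`, `(geomT D).dist`).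
This file is the three-line composition: on every nested torus family and all windowed weights, `H′ = G′²Q′*(Q′G′²Q′*)⁻¹`
(`hPrimeMLT D a (GinvT D a)`) and `R = 1 − G′Q′*(Q′G′²Q′*)⁻¹Q′G′` (`rProjMLT D a (GinvT D a)`) — print's operators (1.91) and (1.27)/(3.25)
themselves at U₀ = 1, no operator argument left — obey the kernel decay, (1.92), the Δ-entry, «Q′H′ = I», the projection identities
and «|Rf| ≦ B′₀|f|», with constants depending on `d, ℓ` and the weight windows only.  Kind «kernel-checked proof of a model
instance»; theorems only; every input BY NAME; 0 sorry; no fact minted.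

WHAT IS PRINTED (verbatim, held text `paper:balaban1985-cmp99-regular-spaces-gauge-fixing`).  p. 91 [p0017 L30–33]: *"Let us
introduce the operators H′ = G′²Q′\*(Q′G′²Q′\*)⁻¹, G′ = (Δ + Q′\*aQ′)⁻¹. (1.91) They were investigated in [4], and the following
inequality can be obtained from the results of this paper: |(H′X)(x)|, |(∇H′X)(x)| ≦ B′₀[1, (Lʲη)⁻¹]|X| for x ∈ Ω_j, (1.92)"*;
p. 92 [p0018 L2–4]: *"where (H′X)(x) = Σ_{y′∈𝔅_k}(L^{j′}η)^d H′(x, y′)X(y′), and B′₀ is an absolute constant (depending on d and L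
only)."*; p. 92 [p0018 L16–17]: *"Let us recall that from Theorems 3.1, 3.2 of [4] it follows that |Rf| ≦ B′₀|f|"*; p. 93 [p0019 L3]
«… and with ΔH′D′(u₁, λ)» (the Δ-entry consumed in (1.99)); p. 96 (1.115) ⇒ (1.116) («Q′H′ = I»).  [B6] CMP **96**
[Balaban1984PropagatorsII] p. 235 [p0013 L19–20]: *"Of course the operator Q′G′²Q′\* is positive definite, so its inverse is well
defined."*; Proposition 2.3 p. 238 [p0016 L13–18]: *"An inverse of the operator Q′G′²Q′\* is given by the convergent expansion … (2.86)
and it satisfies the estimate |(Q′G′²Q′\*)⁻¹(y, y′)| ≦ O(1)(Lʲη)⁻⁴(L^{j′}η)^{−d}e^{−½δ₁d(y,y′)}, y ∈ Λ_j, y′ ∈ Λ_{j′}. (2.87)"*;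
p. 224 «we admit the case when some domains Ω_j are equal to T_η».

HONEST SCOPE / NOT CLAIMED.  As `B8Ineq192MultiLevelTorus(P22)`: print's carrier `T_η` with `Ω₁ = T_η` (levels `1 … k`), `A = 0`
(U₀ = 1), scalar fibre, lattice units (η = 1, lengths `Lʲ`), `∇_μ = dT N₀ μ` (p21's periodic forward difference), `−Δ_T = perLapT N₀`,
`x ∈ Ω_j` read at the point's own level `j = D.lev x`; constants existential (functions of `d, ℓ` and the windows; print: «depending
on d and L only» at the series' fixed `a`); thresholds «M, RM sufficiently large» explicit (`M_h ≥ 3`, `L·M_h ≥ M₀`, `R ≥ 2L`,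
`R·L·M_h ≥ N₀ + 1`, torus periods `P_μ ≥ 4` of p21's charts); p21's (2.87) is obtained by its own route (global (2.78)_T + [3] Sect. 5,
not the expansion (2.86)) — immaterial here, only the statement (2.87) is consumed.  The general (1.92) / «|Rf| ≦ B′₀|f|» at a
background `U₀ ∈ 𝔄_k` ([4] Thms 3.1–3.3) stays the typed leaf of `B8Ineq192` / `B8Ineq192Op`; rows B8.Eq1.91 / B8.Claim@92 heads
NOT changed (owner's word).  NOT summit progress, NOT continuum, NOT Clay.
-/

namespace Literature.MathematicalPhysics.QuantumFieldTheory.Balaban1983to89.B8Ineq192MultiLevelTorusP23L0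

open Finset Matrix
open B4Reflection242 (boxDom)
open B6MultiLevelBoxOperator hiding Domains mlOp_apply
open B6MultiLevelBoxOperatorL0
open B6MultiLevelTorusOperator hiding TDomains mlOpT_apply mlOpT_eq_reindex_chart mlOpT_mul_reindex mlOpT_tshift
open B6MultiLevelTorusOperatorL0
open B6Geom246MultiLevelBox hiding Touch blkOf blkOf_corner blkOf_eq_iff_blk blkOf_eq_of_blk_i_eq blkOf_val bond bond_adj bset cen connected coord_bounds corner corner_mem csys dist_blkOf_le_box dist_blkOf_le_coord dist_blkOf_le_line dist_cen_le_of_adj dist_cen_le_of_touch dist_le_one_of_near dist_toR_cen_le exists_blkOf_eq geom lemma21_box lev_corner lev_eq_of_blkOf_eq levelGap pack reachable_blkOf reachable_of_near realizes scale_bounds touch_symm triangle_refl_nonneg walk_disp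
open B6Geom246MultiLevelBoxL0
open B6Geom246MultiLevelTorus hiding TouchT blkHom blkMap blkMap_blkOf blkMap_injective blkMap_surjective blkOf_tshift_eq bondT bondT_adj bond_le_bondT connectedT csysT distT_le_dist_box distT_le_dist_chart dist_posT_le_of_adj dist_posT_le_of_touchT dist_site_posT_le geomT label_bounds lemma21_torus levelGapT packT posT realizesT touchT_symm triangle_refl_nonneg_T walk_dispT
open B6Geom246MultiLevelTorusL0
open B6Ineq268MultiLevelBox hiding QB QB_apply QsB QsB_apply W W_eq W_pos Xk abs_qB abs_qB_le card_blkOf_le csysB geomB geomB_L geomB_M geomB_R geomB_RM geomB_RM_nonneg geomB_Site geomB_dist geomB_eta geomB_len geom_len ineq268_multiLevelBox instDecidableEqGeomBSite kerOp_Xk levelSepB qB qB_ne_zero realizesB refl_nonnegB sum_abs_qB_le symmB triangleB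
open B6Ineq268MultiLevelBoxL0
open B6RandomWalk (HasMajorant BlockSupp hasMajorant_mono)
open B6Ineq261LevelGap (K261 K261_nonneg theta_lt_one_of_log)
open B6Expansion282 (kerOp)
open B6Prop23Chain (mat)
open B8Ineq192MultiLevelBox (abs_apply_le_of_levelBound levelRowSum_le ineq261With_of_le)
open B8Ineq192MultiLevelTorusL0
open B9Ineq349MultiLevelTorusL0 (pProjMLT rProjMLT_eq_one_sub_pProjMLT ineq349_multiLevelTorus)
open B6Ineq243TwoLevelBox (aNext)
open B6Prop22DerivMultiLevelTorus (dT)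
open B6Prop23MultiLevelTorusL0 (GinvT prop23_multiLevelTorus)
open B8Ineq192MultiLevelTorusP22L0 (hKer_decay_T_P22 ineq192_multiLevelTorus_P22 rProjMLT_sup_bound_P22)
open B8Ineq198MultiLevelTorusP22L0 (prop22_entries1236_multiLevelTorus)

noncomputable section

variable {d : ℕ}

/-- **THE KERNEL OF (1.91) AT U₀ = 1 ON THE `k`-LEVEL TORUS FAMILY DECAYS, WITH THE GENUINE LEVEL PREFACTORS — HYPOTHESIS-FREE**:
there are `ρ, B, M₀ > 0`, `N₀ ≥ 1` (functions of `d, ℓ` and the weight windows) such that for every `k`, `M_h ≥ 3` with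
`L·M_h ≥ M₀`, `R ≥ 2L` with `R·L·M_h ≥ N₀ + 1`, periods `P_μ ≥ 4`, every nested torus family `D` with (2.1)–(2.2) and every windowed
weight sequence: `(Q′G′²Q′*)⁻¹ = GinvT D a` is THE two-sided inverse (`GinvT·(Q′G′²Q′*) = 1 = (Q′G′²Q′*)·GinvT`) and
`H′ = G′²Q′*(Q′G′²Q′*)⁻¹` (`hPrimeMLT D a (GinvT D a)`) satisfies, at every point `x` (level `j = D.lev x`) and every block `y′`,
`|(H′δ_{y′})(x)| ≦ Be^{−ρd_T(y(x),y′)}`, `|(∇_μH′δ_{y′})(x)| ≦ B(Lʲ)⁻¹e^{−ρd_T}` (every axis), `|((−Δ_T)H′δ_{y′})(x)| ≦ B(Lʲ)⁻²e^{−ρd_T}`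
— `B8Ineq192MultiLevelTorus.hPrime_single_decay_T` with its three Prop.-2.2 hypotheses discharged by
`prop22_entries1236_multiLevelTorus` and its `G`-hypothesis by `prop23_multiLevelTorus`.
[cite: Balaban1985RegularSpaces, (1.91)–(1.92) pp.91–92, p.93 l.1–4; Balaban1984PropagatorsII, Prop. 2.3 (2.87) p.238, Prop. 2.2 (2.67) p.234, p.235, p.224 (Ω₁ = T_η admitted)] -/
theorem hPrime_single_decay_T_P23 (d ℓ : ℕ) (hℓ : 1 ≤ ℓ) (aminus aplus a2minus a2plus : ℝ) (ha : 0 < aminus)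
    (ha2 : 0 < a2minus) :
    ∃ ρ B M₀ : ℝ, ∃ N₀ : ℕ, 0 < ρ ∧ 0 < B ∧ 0 < M₀ ∧ 0 < N₀ ∧
      ∀ (k Mh R : ℕ), 3 ≤ Mh → M₀ ≤ ((ℓ : ℝ) + 1) * Mh → 2 * (ℓ + 1) ≤ R → N₀ + 1 ≤ R * ((ℓ + 1) * Mh) →
      ∀ (P : Fin (d + 1) → ℕ) (_hP : ∀ μ, 1 ≤ P μ) (_hP4 : ∀ μ, 4 ≤ P μ) (D : B6MultiLevelTorusOperatorL0.TDomains d ℓ Mh k P R) (a c : ℕ → ℝ),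
        (∀ i, aminus ≤ a i ∧ a i ≤ aplus) → (∀ i, a2minus ≤ c i ∧ c i ≤ a2plus) →
        (∀ i, a (i + 1) = aNext ℓ (a i) (c i)) →
        GinvT D a * kerOp (W D.toDomains) (XkT D a) = 1 ∧ kerOp (W D.toDomains) (XkT D a) * GinvT D a = 1 ∧
        ∀ (x : ↥(boxDom (N0 ℓ Mh k P))) (y' : ↥(bset D.toDomains)),
          |hPrimeMLT D a (GinvT D a) (Pi.single y' 1) x| ≤
            B * Real.exp (-(ρ * (geomT D).dist (blkOf D.toDomains x) y')) ∧
          (∀ μ : Fin (d + 1), |(dT (N0 ℓ Mh k P) μ *ᵥ hPrimeMLT D a (GinvT D a) (Pi.single y' 1)) x| ≤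
            B * (((ℓ : ℝ) + 1) ^ D.lev x.1)⁻¹ * Real.exp (-(ρ * (geomT D).dist (blkOf D.toDomains x) y'))) ∧
          |(perLapT (N0 ℓ Mh k P) *ᵥ hPrimeMLT D a (GinvT D a) (Pi.single y' 1)) x| ≤
            B * ((((ℓ : ℝ) + 1) ^ D.lev x.1) ^ 2)⁻¹ * Real.exp (-(ρ * (geomT D).dist (blkOf D.toDomains x) y')) := by
  obtain ⟨δ₁, C₁, M₁, hδ₁, hC₁, hM₁, hP23⟩ := prop23_multiLevelTorus d ℓ hℓ aminus aplus a2minus a2plus ha ha2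
  obtain ⟨δ₀, C, M₀, N₀, hδ₀, hC, hM₀, hN₀, hE⟩ :=
    prop22_entries1236_multiLevelTorus d ℓ hℓ aminus aplus a2minus a2plus ha ha2
  obtain ⟨ρ, B, N₁, hρ, hB, hN₁, hmain⟩ := hPrime_single_decay_T d ℓ hC hδ₀ hC₁ hδ₁
  refine ⟨ρ, B, max M₀ M₁, max N₀ N₁, hρ, hB, lt_max_of_lt_left hM₀, lt_max_of_lt_left hN₀, ?_⟩
  intro k Mh R hMh hM hRL hRM P hP hP4 D a c haw hcw hac
  have hMh1 : 1 ≤ Mh := le_trans (by norm_num) hMh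
  have hM0 : M₀ ≤ ((ℓ : ℝ) + 1) * Mh := (le_max_left _ _).trans hM
  have hM1 : M₁ ≤ ((ℓ : ℝ) + 1) * Mh := (le_max_right _ _).trans hM
  have hRM0 : N₀ + 1 ≤ R * ((ℓ + 1) * Mh) := le_trans (Nat.succ_le_succ (le_max_left _ _)) hRM
  have hRM1 : N₁ + 1 ≤ R * ((ℓ + 1) * Mh) := le_trans (Nat.succ_le_succ (le_max_right _ _)) hRM
  obtain ⟨h1, h2, -, hG⟩ := hP23 k Mh R hM1 hRL P hP hP4 D a c haw hcw hac
  obtain ⟨hTG, hTD, -, hTL⟩ := hE k Mh R hMh hM0 hRL hRM0 P hP hP4 D a c haw hcw hac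
  exact ⟨h1, h2, hmain k Mh R hMh1 hRM1 P hP D a (fun μ => dT (N0 ℓ Mh k P) μ) (perLapT (N0 ℓ Mh k P)) hTG hTD hTL
    (GinvT D a) hG⟩

/-- **THE (2.69)-KERNEL OF (1.91) ON THE TORUS DECAYS — HYPOTHESIS-FREE**: `|(H′δ_{y′})(x)| ≦ Be^{−ρd_T(y(x),y′)}` and, in the (2.69)
convention of p. 92's display, `|H′(x, y′)| ≦ B(L^{j′})^{−(d+1)}e^{−ρd_T(y(x),y′)}` (`hKerT`), for `H′ = G′²Q′*(Q′G′²Q′*)⁻¹` with the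
GENUINE torus `G′ = gmlT` and THE inverse `GinvT D a`, on every member of the family in print's regime
(`B8Ineq192MultiLevelTorusP22.hKer_decay_T_P22` with its `G`-hypothesis discharged by `prop23_multiLevelTorus`).
[cite: Balaban1985RegularSpaces, (1.91) p.91, p.92 (the display after (1.92)); Balaban1984PropagatorsII, Prop. 2.3 (2.87) p.238, (2.69) p.235, p.224] -/
theorem hKer_decay_T_P23 (d ℓ : ℕ) (hℓ : 1 ≤ ℓ) (aminus aplus a2minus a2plus : ℝ) (ha : 0 < aminus)
    (ha2 : 0 < a2minus) :
    ∃ ρ B M₀ : ℝ, ∃ N₀ : ℕ, 0 < ρ ∧ 0 < B ∧ 0 < M₀ ∧ 0 < N₀ ∧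
      ∀ (k Mh R : ℕ), 3 ≤ Mh → M₀ ≤ ((ℓ : ℝ) + 1) * Mh → 2 * (ℓ + 1) ≤ R → N₀ + 1 ≤ R * ((ℓ + 1) * Mh) →
      ∀ (P : Fin (d + 1) → ℕ) (_hP : ∀ μ, 1 ≤ P μ) (_hP4 : ∀ μ, 4 ≤ P μ) (D : B6MultiLevelTorusOperatorL0.TDomains d ℓ Mh k P R) (a c : ℕ → ℝ),
        (∀ i, aminus ≤ a i ∧ a i ≤ aplus) → (∀ i, a2minus ≤ c i ∧ c i ≤ a2plus) →
        (∀ i, a (i + 1) = aNext ℓ (a i) (c i)) →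
        GinvT D a * kerOp (W D.toDomains) (XkT D a) = 1 ∧ kerOp (W D.toDomains) (XkT D a) * GinvT D a = 1 ∧
        ∀ (x : ↥(boxDom (N0 ℓ Mh k P))) (y' : ↥(bset D.toDomains)),
          |hPrimeMLT D a (GinvT D a) (Pi.single y' 1) x| ≤
            B * Real.exp (-(ρ * (geomT D).dist (blkOf D.toDomains x) y')) ∧
          |hKerT D a (GinvT D a) x y'| ≤
            B * (W D.toDomains y')⁻¹ * Real.exp (-(ρ * (geomT D).dist (blkOf D.toDomains x) y')) := by
  obtain ⟨δ₁, C₁, M₁, hδ₁, hC₁, hM₁, hP23⟩ := prop23_multiLevelTorus d ℓ hℓ aminus aplus a2minus a2plus ha ha2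
  obtain ⟨ρ, B, M₀, N₀, hρ, hB, hM₀, hN₀, h⟩ := hKer_decay_T_P22 d ℓ hℓ aminus aplus a2minus a2plus ha ha2 hC₁ hδ₁
  refine ⟨ρ, B, max M₀ M₁, N₀, hρ, hB, lt_max_of_lt_left hM₀, hN₀, ?_⟩
  intro k Mh R hMh hM hRL hRM P hP hP4 D a c haw hcw hac
  obtain ⟨h1, h2, -, hG⟩ := hP23 k Mh R ((le_max_right _ _).trans hM) hRL P hP hP4 D a c haw hcw hac
  exact ⟨h1, h2, h k Mh R hMh ((le_max_left _ _).trans hM) hRL hRM P hP hP4 D a c haw hcw hac (GinvT D a) hG⟩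

/-- **(1.92) AND THE p. 93 Δ-ENTRY AT U₀ = 1 ON PRINT'S CARRIER `T_η` — HYPOTHESIS-FREE**: «|(H′X)(x)|, |(∇H′X)(x)| ≦
B′₀[1, (Lʲη)⁻¹]|X| for x ∈ Ω_j» and `|((−Δ_T)H′X)(x)| ≦ B′₀(Lʲ)⁻²|X|`, together with «Q′H′ = I», for print's own operator (1.91)
`H′ = G′²Q′*(Q′G′²Q′*)⁻¹` (`hPrimeMLT D a (GinvT D a)`: the GENUINE `k`-level torus `G′ = Δ′_a⁻¹ = gmlT`, `Q′* = QsB`, THE inverse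
`GinvT` of [B6] Prop. 2.3), `∇_μ = dT N₀ μ`, `−Δ_T = perLapT N₀`: there are `B′₀, M₀ > 0`, `N₀ ≥ 1` (functions of `d, ℓ` and the
windows) such that for every member of the family in print's regime, every `X : 𝔅 → ℝ` with `|X(y′)| ≦ S` and every point `x` at its
level `j`: `Q′(H′X) = X`, `|(H′X)(x)| ≦ B′₀S`, `|(∇_μH′X)(x)| ≦ B′₀(Lʲ)⁻¹S`, `|((−Δ_T)H′X)(x)| ≦ B′₀(Lʲ)⁻²S` —
`B8Ineq192MultiLevelTorusP22.ineq192_multiLevelTorus_P22` ∘ `prop23_multiLevelTorus`, «Q′H′ = I» by `QB_hPrimeMLT`.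
[cite: Balaban1985RegularSpaces, (1.91)–(1.92) pp.91–92, p.93 l.1–4, (1.115)–(1.116) p.96; Balaban1984PropagatorsII, Prop. 2.3 (2.87) p.238, Prop. 2.2 (2.67) p.234, p.235, p.224] -/
theorem ineq192_multiLevelTorus_P23 (d ℓ : ℕ) (hℓ : 1 ≤ ℓ) (aminus aplus a2minus a2plus : ℝ) (ha : 0 < aminus)
    (ha2 : 0 < a2minus) :
    ∃ B₀' M₀ : ℝ, ∃ N₀ : ℕ, 0 < B₀' ∧ 0 < M₀ ∧ 0 < N₀ ∧
      ∀ (k Mh R : ℕ), 3 ≤ Mh → M₀ ≤ ((ℓ : ℝ) + 1) * Mh → 2 * (ℓ + 1) ≤ R → N₀ + 1 ≤ R * ((ℓ + 1) * Mh) →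
      ∀ (P : Fin (d + 1) → ℕ) (_hP : ∀ μ, 1 ≤ P μ) (_hP4 : ∀ μ, 4 ≤ P μ) (D : B6MultiLevelTorusOperatorL0.TDomains d ℓ Mh k P R) (a c : ℕ → ℝ),
        (∀ i, aminus ≤ a i ∧ a i ≤ aplus) → (∀ i, a2minus ≤ c i ∧ c i ≤ a2plus) →
        (∀ i, a (i + 1) = aNext ℓ (a i) (c i)) →
        GinvT D a * kerOp (W D.toDomains) (XkT D a) = 1 ∧ kerOp (W D.toDomains) (XkT D a) * GinvT D a = 1 ∧
        (∀ X : ↥(bset D.toDomains) → ℝ, QB D.toDomains (hPrimeMLT D a (GinvT D a) X) = X) ∧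
        ∀ (X : ↥(bset D.toDomains) → ℝ) (S : ℝ), 0 ≤ S → (∀ y', |X y'| ≤ S) →
          ∀ x : ↥(boxDom (N0 ℓ Mh k P)),
            |hPrimeMLT D a (GinvT D a) X x| ≤ B₀' * S ∧
            (∀ μ : Fin (d + 1), |(dT (N0 ℓ Mh k P) μ *ᵥ hPrimeMLT D a (GinvT D a) X) x| ≤
              B₀' * (((ℓ : ℝ) + 1) ^ D.lev x.1)⁻¹ * S) ∧
            |(perLapT (N0 ℓ Mh k P) *ᵥ hPrimeMLT D a (GinvT D a) X) x| ≤
              B₀' * ((((ℓ : ℝ) + 1) ^ D.lev x.1) ^ 2)⁻¹ * S := by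
  obtain ⟨δ₁, C₁, M₁, hδ₁, hC₁, hM₁, hP23⟩ := prop23_multiLevelTorus d ℓ hℓ aminus aplus a2minus a2plus ha ha2
  obtain ⟨B₀', M₀, N₀, hB, hM₀, hN₀, h⟩ := ineq192_multiLevelTorus_P22 d ℓ hℓ aminus aplus a2minus a2plus ha ha2 hC₁ hδ₁
  refine ⟨B₀', max M₀ M₁, N₀, hB, lt_max_of_lt_left hM₀, hN₀, ?_⟩
  intro k Mh R hMh hM hRL hRM P hP hP4 D a c haw hcw hac
  obtain ⟨h1, h2, -, hG⟩ := hP23 k Mh R ((le_max_right _ _).trans hM) hRL P hP hP4 D a c haw hcw hac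
  exact ⟨h1, h2, fun X => QB_hPrimeMLT h2 X,
    h k Mh R hMh ((le_max_left _ _).trans hM) hRL hRM P hP hP4 D a c haw hcw hac (GinvT D a) hG⟩

/-- **«|Rf| ≦ B′₀|f|» (p. 92) AT U₀ = 1 ON PRINT'S CARRIER `T_η` — HYPOTHESIS-FREE**, for print's own gauge-fixing projection
`R = 1 − G′Q′*(Q′G′²Q′*)⁻¹Q′G′` of (1.27) / [4] (3.25) (`rProjMLT D a (GinvT D a)`, THE inverse of [B6] Prop. 2.3 inside), together
with its projection identities `Q′G′R = 0`, `R·G′Q′* = 0`, `R² = R`: there are `B′₀, M₀ > 0`, `N₀ ≥ 1` such that for every member of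
the torus family in print's regime, every fine `f` with `|f(z)| ≦ S` and every point `x`: `|(Rf)(x)| ≦ B′₀S` —
`B8Ineq192MultiLevelTorusP22.rProjMLT_sup_bound_P22` ∘ `prop23_multiLevelTorus`; identities by `QB_gmlT_rProjMLT`, `rProjMLT_gmlT_QsB`,
`rProjMLT_idem`. [cite: Balaban1985RegularSpaces, p.92, (1.27) p.80; Balaban1985BackgroundPropagators, (3.25) p.394; Balaban1984PropagatorsII, Prop. 2.3 (2.87) p.238, p.235, p.224; Balaban1984PropagatorsI, p.25] -/
theorem rProjMLT_sup_bound_P23 (d ℓ : ℕ) (hℓ : 1 ≤ ℓ) (aminus aplus a2minus a2plus : ℝ) (ha : 0 < aminus)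
    (ha2 : 0 < a2minus) :
    ∃ B₀' M₀ : ℝ, ∃ N₀ : ℕ, 0 < B₀' ∧ 0 < M₀ ∧ 0 < N₀ ∧
      ∀ (k Mh R : ℕ), 3 ≤ Mh → M₀ ≤ ((ℓ : ℝ) + 1) * Mh → 2 * (ℓ + 1) ≤ R → N₀ + 1 ≤ R * ((ℓ + 1) * Mh) →
      ∀ (P : Fin (d + 1) → ℕ) (_hP : ∀ μ, 1 ≤ P μ) (_hP4 : ∀ μ, 4 ≤ P μ) (D : B6MultiLevelTorusOperatorL0.TDomains d ℓ Mh k P R) (a c : ℕ → ℝ),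
        (∀ i, aminus ≤ a i ∧ a i ≤ aplus) → (∀ i, a2minus ≤ c i ∧ c i ≤ a2plus) →
        (∀ i, a (i + 1) = aNext ℓ (a i) (c i)) →
        GinvT D a * kerOp (W D.toDomains) (XkT D a) = 1 ∧ kerOp (W D.toDomains) (XkT D a) * GinvT D a = 1 ∧
        (∀ f, QB D.toDomains (gmlT (N0 ℓ Mh k P) ℓ k D.lev a *ᵥ rProjMLT D a (GinvT D a) f) = 0) ∧
        (∀ Xc, rProjMLT D a (GinvT D a) (gmlT (N0 ℓ Mh k P) ℓ k D.lev a *ᵥ QsB D.toDomains Xc) = 0) ∧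
        (∀ f, rProjMLT D a (GinvT D a) (rProjMLT D a (GinvT D a) f) = rProjMLT D a (GinvT D a) f) ∧
        ∀ (f : ↥(boxDom (N0 ℓ Mh k P)) → ℝ) (S : ℝ), 0 ≤ S → (∀ z, |f z| ≤ S) →
          ∀ x : ↥(boxDom (N0 ℓ Mh k P)), |rProjMLT D a (GinvT D a) f x| ≤ B₀' * S := by
  obtain ⟨δ₁, C₁, M₁, hδ₁, hC₁, hM₁, hP23⟩ := prop23_multiLevelTorus d ℓ hℓ aminus aplus a2minus a2plus ha ha2
  obtain ⟨B₀', M₀, N₀, hB, hM₀, hN₀, h⟩ := rProjMLT_sup_bound_P22 d ℓ hℓ aminus aplus a2minus a2plus ha ha2 hC₁ hδ₁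
  refine ⟨B₀', max M₀ M₁, N₀, hB, lt_max_of_lt_left hM₀, hN₀, ?_⟩
  intro k Mh R hMh hM hRL hRM P hP hP4 D a c haw hcw hac
  obtain ⟨h1, h2, -, hG⟩ := hP23 k Mh R ((le_max_right _ _).trans hM) hRL P hP hP4 D a c haw hcw hac
  exact ⟨h1, h2, fun f => QB_gmlT_rProjMLT h2 f, fun Xc => rProjMLT_gmlT_QsB h1 Xc, fun f => rProjMLT_idem h2 f,
    h k Mh R hMh ((le_max_left _ _).trans hM) hRL hRM P hP hP4 D a c haw hcw hac (GinvT D a) hG⟩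

end

end Literature.MathematicalPhysics.QuantumFieldTheory.Balaban1983to89.B8Ineq192MultiLevelTorusP23L0
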